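import Summits.BirchSwinnertonDyer.BirchSwinnertonDyer.Theorems.ManinLocalTwoThreeStevensIntegralityCES
import Summits.BirchSwinnertonDyer.BirchSwinnertonDyer.Theorems.ManinLocalTwoThreeExistsMinimalOptimalDatumUnconditional
import Summits.BirchSwinnertonDyer.BirchSwinnertonDyer.Theorems.ManinLocalTwoThreeNaturalTes75OfOptimalTwin
import Literature.NumberTheory.EllipticCurves.NeronIsogenyScalingHoldsProofs
import HarnessLib

/-!
# The Manin constant of an ARBITRARY `X₁(N)`-parametrisation is an integer; Stevens' constant of a class is well defined
# (route `ManinLocalTwoThree`, cruxes C2 stmt-BirchSwinnertonDyer-22967 / C3 stmt-…-22968; cell bsd-f2-manin, prover p2 gen 25;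
# CES-discharge programme, stage 3 — corollaries)

With CES a theorem (`StevensIntegrality.exists_optimal_gamma1ParametrizationData_holds`: a globally minimal `W₁` with an OPTIMAL `X₁(N)`-datum,
`Λ_{W₁} = c₁·Λ₁(f)`, `c₁ ∈ ℤ`) and the integrality of the Néron scaling of a rational isogeny between globally minimal curves
(`integral_neronScaling_of_isGloballyMinimal_holds`), the `X₁(N)`-twin of the Stevens-strength integrality follows:

* `int_of_smul_periodLatticeGamma1_le` — for a globally minimal elliptic `W'/ℚ`, an `X₁(N)`-datum `D'` of `W'` and `q ∈ ℚ` with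
  `q·Λ₁(D'.f) ⊆ Λ_{W'}` (an `X₁(N)`-parametrisation of `W'` with «Manin constant» `q`): **`q ∈ ℤ`** (Conrad–Edixhoven–Stein 2003,
  Lemma 6.1.6 / Stevens 1989 §1: `c_φ ∈ ℤ` for EVERY `φ : X₁(N) → E`, not only the optimal one);
* `int_of_smul_periodLatticeGamma1_le_of_datum₀` — the same for a curve given with an `X₀(N)`-datum;
* `stevensConstant_natAbs_eq` — **Stevens' constant is an invariant of the class**: two optimal `X₁(N)`-data of `ℚ`-isogenous globally
  minimal curves have the same `|c₁|` (each divides the other by Néron scaling).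

Fact-free; standard axioms; no definitions.  BSD is not proved; Manin's `c₀ = ±1`, Stevens' `c₁ = ±1`, C2, C3 are not proved.
[cite: ConradEdixhovenStein2003, §6.1, Lemma 6.1.6] [cite: Stevens1989, §1 Thm. 1.3 and §2] [cite: EdixhovenManin1991, Prop. 2]
-/

set_option autoImplicit false
-- lint-debt: the directory name repeats the summit name (sibling precedent `ManinLocalTwoThreeStevensCurveDatum.lean`)
set_option linter.dupNamespace false

noncomputable section

open scoped MatrixGroups ModularForm
open CongruenceSubgroup WeierstrassCurve
open Literature.NumberTheory.EllipticCurves Literature.NumberTheory.EllipticCurves.ModularForms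
open Summit.BirchSwinnertonDyer.BirchSwinnertonDyer.Theorems.ManinLocalTwoThree

namespace Summit.BirchSwinnertonDyer.BirchSwinnertonDyer.Theorems.ManinLocalTwoThree.StevensIntegrality

variable {N : ℕ} [NeZero N]

/-- **The Manin constant of an arbitrary `X₁(N)`-parametrisation of a curve with an `X₀(N)`-datum is an integer.**  For a globally minimal
elliptic `W'/ℚ` with an `X₀(N)`-datum `D'` and `q ∈ ℚ` with `q·Λ₁(D'.f) ⊆ Λ_{W'}`: `q ∈ ℤ`.  Proof: the class of `W'` has a lattice-optimal
minimal `X₀`-member (`ExistsMinimalOptimalDatum.existsMinimalOptimalDatum`, unconditional), hence (CES) a globally minimal `W₁` with Néron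
lattice EXACTLY `c₁·Λ₁(f)`, `c₁ ∈ ℤ`; the rational isogeny `W₁ → W'`, `z ↦ (q/c₁)·z`, has integral Néron scaling, so `q ∈ c₁ℤ`.
[cite: ConradEdixhovenStein2003, Lemma 6.1.6] [cite: Stevens1989, §1 Thm. 1.3] -/
theorem int_of_smul_periodLatticeGamma1_le_of_datum₀ {W' : WeierstrassCurve ℚ} [W'.IsElliptic] [W'.IsGloballyMinimal]
    (D' : ModularParametrizationData W' N) (q : ℚ) (hq : ∀ z ∈ periodLatticeGamma1 D'.f, (q : ℂ) * z ∈ D'.L.lattice) :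
    ∃ k : ℤ, (k : ℚ) = q := by
  obtain ⟨W₀, hW₀, hW₀', D₀, hf₀, hopt₀⟩ := ExistsMinimalOptimalDatum.existsMinimalOptimalDatum W' D'
  haveI := hW₀
  haveI := hW₀'
  obtain ⟨W₁, hW₁, hW₁', D₁, hiso, h₁⟩ := exists_optimal_gamma1ParametrizationData_holds W₀ D₀ hopt₀
  haveI := hW₁
  haveI := hW₁'
  have hf₁ : D₁.f = D'.f := (D₁.f_eq_of_isIsogenous D₀ hiso).trans hf₀
  have hc₁ : (D₁.c : ℚ) ≠ 0 := by exact_mod_cast D₁.maninConstant_ne_zero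
  have hc₁C : (D₁.c : ℂ) ≠ 0 := by exact_mod_cast D₁.maninConstant_ne_zero
  obtain ⟨k, hk⟩ := integral_neronScaling_of_isGloballyMinimal_holds W₁ W' D₁.L D'.L D₁.isNeronLattice D'.isNeronLattice
    (q / D₁.c) (fun z hz ↦ by
      obtain ⟨w, hw, rfl⟩ := h₁ z hz
      rw [hf₁] at hw
      have e : (((q / D₁.c : ℚ)) : ℂ) * ((D₁.c : ℂ) * w) = (q : ℂ) * w := by
        push_cast
        field_simp
      rw [e]
      exact hq w hw)
  refine ⟨k * D₁.c, ?_⟩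
  rw [Int.cast_mul, hk]
  field_simp

/-- **The Manin constant of EVERY `X₁(N)`-parametrisation is an integer** (Conrad–Edixhoven–Stein 2003, Lemma 6.1.6 / Stevens 1989 §1, in
the tree's lattice rendering): for a globally minimal elliptic `W'/ℚ` with an `X₁(N)`-datum `D'` and `q ∈ ℚ` with `q·Λ₁(D'.f) ⊆ Λ_{W'}`,
`q ∈ ℤ` (via the `X₀(N)`-datum with the same lattice, `NaturalTes75.exists_modularParametrizationData_of_gamma1`).
[cite: ConradEdixhovenStein2003, Lemma 6.1.6] [cite: Stevens1989, §1 Thm. 1.3] -/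
theorem int_of_smul_periodLatticeGamma1_le {W' : WeierstrassCurve ℚ} [W'.IsElliptic] [W'.IsGloballyMinimal]
    (D' : Gamma1ParametrizationData W' N) (q : ℚ) (hq : ∀ z ∈ periodLatticeGamma1 D'.f, (q : ℂ) * z ∈ D'.L.lattice) :
    ∃ k : ℤ, (k : ℚ) = q := by
  obtain ⟨D₀, hf, hL, -⟩ := NaturalTes75.exists_modularParametrizationData_of_gamma1 D'
  exact int_of_smul_periodLatticeGamma1_le_of_datum₀ D₀ q (fun z hz ↦ by
    rw [hL]
    exact hq z (by rwa [hf] at hz))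

/-- **Stevens' constant is an invariant of the isogeny class**: two OPTIMAL `X₁(N)`-data of `ℚ`-isogenous globally minimal curves have
Manin constants of the same absolute value (each scaling `c₂/c₁`, `c₁/c₂` is an integral Néron scaling). [cite: Stevens1989, §2]
[cite: ConradEdixhovenStein2003, §6.1] -/
theorem stevensConstant_natAbs_eq {W₁ W₂ : WeierstrassCurve ℚ} [W₁.IsElliptic] [W₁.IsGloballyMinimal] [W₂.IsElliptic]
    [W₂.IsGloballyMinimal] (D₁ : Gamma1ParametrizationData W₁ N) (D₂ : Gamma1ParametrizationData W₂ N)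
    (hiso : IsIsogenous W₁ W₂) (h₁ : D₁.IsOptimal) (h₂ : D₂.IsOptimal) :
    D₁.maninConstant.natAbs = D₂.maninConstant.natAbs := by
  -- same newform
  obtain ⟨D₂₀, hf₂₀, -, -⟩ := NaturalTes75.exists_modularParametrizationData_of_gamma1 D₂
  have hf : D₁.f = D₂.f := (D₁.f_eq_of_isIsogenous D₂₀ hiso).trans hf₂₀
  have hc₁ : (D₁.c : ℚ) ≠ 0 := by exact_mod_cast D₁.maninConstant_ne_zero
  have hc₂ : (D₂.c : ℚ) ≠ 0 := by exact_mod_cast D₂.maninConstant_ne_zero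
  have hc₁C : (D₁.c : ℂ) ≠ 0 := by exact_mod_cast D₁.maninConstant_ne_zero
  have hc₂C : (D₂.c : ℂ) ≠ 0 := by exact_mod_cast D₂.maninConstant_ne_zero
  -- `c₂/c₁` and `c₁/c₂` are integers
  obtain ⟨a, ha⟩ := integral_neronScaling_of_isGloballyMinimal_holds W₁ W₂ D₁.L D₂.L D₁.isNeronLattice D₂.isNeronLattice
    (D₂.c / D₁.c) (fun z hz ↦ by
      obtain ⟨w, hw, rfl⟩ := h₁ z hz
      have e : (((D₂.c / D₁.c : ℚ)) : ℂ) * ((D₁.c : ℂ) * w) = (D₂.c : ℂ) * w := by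
        push_cast
        field_simp
      rw [e]
      exact D₂.smul_periodLatticeGamma1_le w (by rwa [hf] at hw))
  obtain ⟨b, hb⟩ := integral_neronScaling_of_isGloballyMinimal_holds W₂ W₁ D₂.L D₁.L D₂.isNeronLattice D₁.isNeronLattice
    (D₁.c / D₂.c) (fun z hz ↦ by
      obtain ⟨w, hw, rfl⟩ := h₂ z hz
      have e : (((D₁.c / D₂.c : ℚ)) : ℂ) * ((D₂.c : ℂ) * w) = (D₁.c : ℂ) * w := by
        push_cast
        field_simp
      rw [e]
      exact D₁.smul_periodLatticeGamma1_le w (by rwa [← hf] at hw))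
  have h2 : D₂.c = a * D₁.c := by
    have e : (D₂.c : ℚ) = a * D₁.c := by rw [ha]; field_simp
    exact_mod_cast e
  have h1 : D₁.c = b * D₂.c := by
    have e : (D₁.c : ℚ) = b * D₂.c := by rw [hb]; field_simp
    exact_mod_cast e
  change D₁.c.natAbs = D₂.c.natAbs
  exact Nat.dvd_antisymm (Int.natAbs_dvd_natAbs.mpr ⟨a, by rw [h2, mul_comm]⟩)
    (Int.natAbs_dvd_natAbs.mpr ⟨b, by rw [h1, mul_comm]⟩)

end Summit.BirchSwinnertonDyer.BirchSwinnertonDyer.Theorems.ManinLocalTwoThree.StevensIntegrality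

end
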